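import Mathlib
import Summits.NavierStokesRegularity.NavierStokesRegularity.Theses.ThinOrFatPincer
import Summits.NavierStokesRegularity.NavierStokesRegularity.Theorems.TypeICertificateLadderNoBlowupToClay
import HarnessLib

/-!
# Route ThinOrFatPincer — support items `KatoToClay` (stmt-NavierStokesRegularity-10486) and
  `ClayDataInL3` (stmt-NavierStokesRegularity-8963) PROVED

* `thinOrFatPincer_katoToClay_proof`: a global Kato solution from a Clay datum upgrades to a Clay
  (A) solution — verbatim the tree's named fact `clay_solution_of_hasGlobalKatoSolution`
  (PROVED, `clay_solution_of_hasGlobalKatoSolution_holds`; Kato 1984 Thm 4 with Lemarié-Rieusset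
  2002 Ch. 15/27), with `HasGlobalKatoSolution` unfolded.
* `thinOrFatPincer_clayDataInL3_proof`: a Clay datum (smooth, divergence-free, rapidly decaying)
  is in `L³` and weakly divergence free — the `L³` step of
  `typeICertificateLadder_noBlowupToClay_proof` (`L^∞ ∩ L²` interpolation `eLpNorm_three_pow_le`)
  and `VectorCalculus.IsDivFree.isWeaklyDivFree_holds`.

HONEST FRAMING: bookkeeping over PROVED tree facts; nothing here bears on the regularity question.
Lands `--workitem stmt-NavierStokesRegularity-10486` (typer seat g19 of cell pub-ns-dss, idle-row
item; `ClayDataInL3` closed `--by` the second theorem).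
-/

noncomputable section

namespace Summit.NavierStokesRegularity.NavierStokesRegularity.Theorems

set_option linter.dupNamespace false

open MeasureTheory
open scoped ENNReal
open Literature.Analysis.FluidPDE

/-- **`KatoToClay` of route ThinOrFatPincer (stmt-NavierStokesRegularity-10486)** = the tree's
`clay_solution_of_hasGlobalKatoSolution_holds` (its hypothesis `HasGlobalKatoSolution ν u₀`
unfolded). [this file] -/
theorem thinOrFatPincer_katoToClay_proof : Theses.ThinOrFatPincer.KatoToClay :=
  fun ν hν u₀ hsm hdiv hdec hK => clay_solution_of_hasGlobalKatoSolution_holds ν hν u₀ hsm hdiv hdec hK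

/-- **`ClayDataInL3` of route ThinOrFatPincer (stmt-NavierStokesRegularity-8963)**: a smooth,
divergence-free, rapidly decaying datum lies in `L³(ℝ³)` (`‖u₀‖₃³ ≤ ‖u₀‖_∞ ‖u₀‖₂²`, both finite
by rapid decay) and is weakly divergence free (`IsDivFree.isWeaklyDivFree_holds`). [this file] -/
theorem thinOrFatPincer_clayDataInL3_proof : Theses.ThinOrFatPincer.ClayDataInL3 := by
  intro u₀ hsm hdiv hdec
  have hHk : ∀ n : ℕ, ∫⁻ x, ‖iteratedFDeriv ℝ n u₀ x‖ₑ ^ 2 < ⊤ :=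
    hdec.lintegral_enorm_iteratedFDeriv_sq_lt_top
  have hmeas0 : AEStronglyMeasurable u₀ volume := hsm.continuous.aestronglyMeasurable
  have hL2 : ∫⁻ x, ‖u₀ x‖ₑ ^ 2 < ⊤ := by
    refine lt_of_le_of_lt (le_of_eq (lintegral_congr fun x => ?_)) (hHk 0)
    rw [← ofReal_norm, ← ofReal_norm, norm_iteratedFDeriv_zero]
  have hu2 : MemLp u₀ 2 volume := ⟨hmeas0, eLpNorm_two_lt_top_of_lintegral_enorm_sq_lt_top hL2⟩
  obtain ⟨C₀, hC₀⟩ := hdec 0 0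
  have hbd0 : ∀ x, ‖u₀ x‖ ≤ C₀ := fun x => by
    have h := hC₀ x
    rwa [pow_zero, one_mul, norm_iteratedFDeriv_zero] at h
  have hu3 : MemLp u₀ 3 volume := by
    refine ⟨hmeas0, ?_⟩
    have h3 : eLpNorm u₀ 3 volume ^ 3 ≤ eLpNorm u₀ ⊤ volume * eLpNorm u₀ 2 volume ^ 2 :=
      eLpNorm_three_pow_le hmeas0
    have htop : eLpNorm u₀ ⊤ volume ≤ ENNReal.ofReal C₀ := eLpNorm_top_le_of_bound hbd0
    have hfin : eLpNorm u₀ ⊤ volume * eLpNorm u₀ 2 volume ^ 2 < ⊤ :=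
      ENNReal.mul_lt_top (htop.trans_lt ENNReal.ofReal_lt_top)
        (ENNReal.pow_lt_top hu2.eLpNorm_lt_top)
    by_contra hnot
    rw [not_lt, top_le_iff] at hnot
    rw [hnot, ENNReal.top_pow (by norm_num)] at h3
    exact absurd (h3.trans_lt hfin) (lt_irrefl _)
  have hdiv' : VectorCalculus.IsDivFree u₀ := fun x => hdiv x
  have hwdiv : IsWeaklyDivFree u₀ :=
    VectorCalculus.IsDivFree.isWeaklyDivFree_holds hdiv' (hsm.of_le (mod_cast le_top))
  exact ⟨hu3, hwdiv⟩

end Summit.NavierStokesRegularity.NavierStokesRegularity.Theorems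

end
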